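import Mathlib
import Summits.ValiantsHypothesis.ValiantsHypothesis.Theses.BorderApolarity
import Literature.Computability.AlgebraicComplexity.Apolarity
import Literature.Computability.AlgebraicComplexity.ApolarityAction
import Literature.Computability.AlgebraicComplexity.BorderApolarityMembership
import Summits.ValiantsHypothesis.ValiantsHypothesis.Theorems.BorderApolarityToricFixedPointsToricLimitIsInitial
import Summits.ValiantsHypothesis.ValiantsHypothesis.Theorems.BorderApolarityFixedWitnessObstructionQPNecessity
import Summits.ValiantsHypothesis.ValiantsHypothesis.Theorems.BorderApolarityToricWitnessObstructionQPStubNormalForm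
import Summits.ValiantsHypothesis.ValiantsHypothesis.Theorems.BorderApolarityToricWitnessObstructionQPStubSocleMaxRel
import Summits.ValiantsHypothesis.ValiantsHypothesis.Theorems.BorderApolarityToricWitnessObstructionQPStubLimitTransfer
import Summits.ValiantsHypothesis.ValiantsHypothesis.Theorems.BorderApolarityToricWitnessObstructionQPStubNormalFormRel
import Summits.ValiantsHypothesis.ValiantsHypothesis.Theorems.BorderApolarityToricWitnessObstructionQPStubStabHom
import Summits.ValiantsHypothesis.ValiantsHypothesis.Theorems.BorderApolarityToricWitnessObstructionQPStubStabTorus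
import Summits.ValiantsHypothesis.ValiantsHypothesis.Theorems.BorderApolarityToricWitnessObstructionQPStubStabScalarBorel
import Summits.ValiantsHypothesis.ValiantsHypothesis.Theorems.BorderApolarityToricWitnessObstructionQPInitialFormApolarTop
import Summits.ValiantsHypothesis.ValiantsHypothesis.Theorems.BorderApolarityToricWitnessObstructionQPRawW4OfCleanStabilities

/-!
# Border apolarity, crux `ToricWitnessObstructionQP` (stmt-ValiantsHypothesis-14753) — the crux is
# EQUIVALENT to its stable algebraic normal form (line `Sketch`, reshape 4, lead c2)

Route `ValiantsHypothesis/BorderApolarity`, crux item `stmt-ValiantsHypothesis-14753`.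

`toricWitnessObstructionQP_iff_noStableNormalForm`: the crux — no TORIC Borel-fixed border-apolar
witness `(u, g, w, J)` for the padded permanent `pp = X₀₀^{m-n} per_n` in the quasi-polynomial window —
holds if and only if, in the same window, there are no STABLE NORMAL-FORM data `(g, w, e, q)`:
`pp = wHC_w^e (g · det_m)` extremal (`u = 1`), `w` exchange-additive on the per-block, and the
lowest-`w`-weight initial spans `J'_k := in_w(Ann_k(g · det_m))`, `k ≤ m`, stable under the clean
pattern torus on the own variables (ST), all substitutions `∂_y ↦ ∂_y + Σ_z C_{zy} ∂_z` (SH), the clean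
unused scalings (SZ), and the `q`-conjugate of the own-trivial part of `H₀(n,m)` (SB), `q` fixing the
own variables.  The statement is purely algebraic: no `u`, no limits, no abstract `J`.

* (⇐, the line's composition) witness ⟹ data: extremal socle step (`stub_socleMaxRel`), normal form
  with the conjugating matrix exported (`stub_normalFormRel`), identification of the Kuratowski limit
  with the translated initial span of the NEW datum (`stub_limitTransfer`, over crux 3's
  `tli_isBorderApolarLimit_toric`), and the three unpackings of W4 (`stub_stabHom`, `stub_stabTorus`,
  `stub_stabScalarBorel`).
* (⇒) data ⟹ witness `(q, g, w, J := {D : qᵀ D ∈ J'})`: W2 ∧ W3 by `stub_toricLimitIsInitial`; W4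
  reassembled from (ST), (SH), (SB) (`rawW4_of_cleanStabilities`); W5 because lowest-weight initial
  forms of annihilators kill the top component (`initialForm_apolar_topComponent`) and `q` fixes `pp`.

Consequence: the residual stub of line `Sketch` (reshape 4) is EXACTLY crux-sized — neither weaker
(it closes the crux) nor stronger (the crux gives it back).
-/

open MvPolynomial Filter
open scoped BigOperators Matrix
open Literature.Computability.AlgebraicComplexity

-- the mandated summit-side namespace repeats a component by design (single-problem summit)
set_option linter.dupNamespace false

namespace Summit.ValiantsHypothesis.ValiantsHypothesis.Theorems.BorderApolarityToricWitnessObstructionQP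

noncomputable section

/-! ## Small glue -/

/-- Casting ℕ-weights to ℤ does not change weighted homogeneous components of ℕ-weight. [folklore] -/
theorem snf_weightedHomogeneousComponent_natCast {σ : Type*} (w : σ → ℕ) (e : ℕ)
    (F : MvPolynomial σ ℂ) :
    weightedHomogeneousComponent (fun i => (w i : ℤ)) (e : ℤ) F = weightedHomogeneousComponent w e F := by
  classical
  ext d
  simp only [coeff_weightedHomogeneousComponent,
    BorderApolarityFixedWitnessObstructionQP.weight_natCast_eq, Nat.cast_inj]

/-- If `J_k = {D : pᵀ D ∈ J'_k}` for `k ≤ m` and `J` is stable under `Mᵀ`, then `J'` is stable under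
`(p⁻¹ M p)ᵀ`. [folklore] -/
theorem snf_rawW4_transfer {m : ℕ} (p : GL (Fin m × Fin m) ℂ)
    (J J' : ℕ → Set (MvPolynomial (Fin m × Fin m) ℂ))
    (hJ : ∀ k ≤ m, J k = {D | linSubst (Fin m × Fin m) ℂ (p : Matrix (Fin m × Fin m) (Fin m × Fin m) ℂ)ᵀ D ∈ J' k})
    (M : Matrix (Fin m × Fin m) (Fin m × Fin m) ℂ)
    (hM : ∀ k ≤ m, ∀ D ∈ J k, linSubst (Fin m × Fin m) ℂ Mᵀ D ∈ J k) :
    ∀ k ≤ m, ∀ D ∈ J' k,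
      linSubst (Fin m × Fin m) ℂ (((p⁻¹ : GL (Fin m × Fin m) ℂ) : Matrix (Fin m × Fin m) (Fin m × Fin m) ℂ) *
        M * (p : Matrix (Fin m × Fin m) (Fin m × Fin m) ℂ))ᵀ D ∈ J' k := by
  intro k hk D hD
  have hpinv : (p : Matrix (Fin m × Fin m) (Fin m × Fin m) ℂ)ᵀ *
      (((p⁻¹ : GL (Fin m × Fin m) ℂ) : Matrix (Fin m × Fin m) (Fin m × Fin m) ℂ))ᵀ = 1 := by
    rw [← Matrix.transpose_mul, Units.inv_mul, Matrix.transpose_one]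
  set D₀ := linSubst (Fin m × Fin m) ℂ
    (((p⁻¹ : GL (Fin m × Fin m) ℂ) : Matrix (Fin m × Fin m) (Fin m × Fin m) ℂ))ᵀ D with hD₀
  have hD₀J : D₀ ∈ J k := by
    rw [hJ k hk, Set.mem_setOf_eq, hD₀, ← AlgHom.comp_apply, ← linSubst_mul, hpinv, linSubst_one,
      AlgHom.id_apply]
    exact hD
  have h := hM k hk D₀ hD₀J
  rw [hJ k hk, Set.mem_setOf_eq, hD₀, ← AlgHom.comp_apply, ← linSubst_mul, ← AlgHom.comp_apply,
    ← linSubst_mul] at h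
  rw [Matrix.transpose_mul, Matrix.transpose_mul, ← Matrix.mul_assoc]
  exact h


/-! ## Normal-form data assemble a toric witness -/

/-- **Stable normal-form data give a toric witness.**  For `(g, w, e, q)` with `pp = wHC_w^e(g·det_m)`
extremal, `q` fixing the own variables, and the initial spans `J'_k := in_w(Ann_k(g·det_m))` stable
under the clean pattern torus (ST), the Hom-substitutions (SH) and the `q`-conjugate own-trivial part
of `H₀` (SB): along the toric curve `Q_t := q · diag((t+2)^w) · g · det_m` the family
`J_k := {D : qᵀ D ∈ J'_k}` is the Kuratowski limit of the annihilators (crux 3's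
`stub_toricLimitIsInitial`), is `H₀(n,m)`-stable (`rawW4_of_cleanStabilities`), and annihilates `pp`
(`initialForm_apolar_topComponent` + `q · pp = pp`). [folklore] -/
theorem snf_witness_of_stableData (n m : ℕ) [NeZero m] (g : GL (Fin m × Fin m) ℂ)
    (w : Fin m × Fin m → ℕ) (e : ℕ) (q : GL (Fin m × Fin m) ℂ)
    (hext : ∀ d ∈ (linSubst (Fin m × Fin m) ℂ (g : Matrix (Fin m × Fin m) (Fin m × Fin m) ℂ)
      (detPoly (Fin m) ℂ)).support, Finsupp.weight w d ≤ e)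
    (hrep : paddedPerPoly ℂ n m = weightedHomogeneousComponent w e
      (linSubst (Fin m × Fin m) ℂ (g : Matrix (Fin m × Fin m) (Fin m × Fin m) ℂ) (detPoly (Fin m) ℂ)))
    (hST : ∀ t : Fin m × Fin m → ℂ, (∀ i, t i ≠ 0) →
      (∀ z : Fin m × Fin m, ¬ (((m - n ≤ (z.1 : ℕ) ∧ m - n ≤ (z.2 : ℕ)) ∨ z = (0, 0))) → t z = 1) →
      (∀ i k j l : Fin m, m - n ≤ (i : ℕ) → m - n ≤ (k : ℕ) → m - n ≤ (j : ℕ) → m - n ≤ (l : ℕ) →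
        t (i, j) * t (k, l) = t (i, l) * t (k, j)) →
      t (0, 0) ^ (m - n) * ∏ i ∈ Finset.univ.filter (fun i : Fin m => m - n ≤ (i : ℕ)), t (i, i) = 1 →
      ∀ k ≤ m, ∀ D ∈ Submodule.span ℂ {D' : MvPolynomial (Fin m × Fin m) ℂ |
          ∃ E ∈ annihilatorOfDegree
            (linSubst (Fin m × Fin m) ℂ (g : Matrix (Fin m × Fin m) (Fin m × Fin m) ℂ) (detPoly (Fin m) ℂ)) k,
          ∃ ν : ℤ, D' = weightedHomogeneousComponent (fun i => (w i : ℤ)) ν E ∧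
            ∀ ν' : ℤ, ν' < ν → weightedHomogeneousComponent (fun i => (w i : ℤ)) ν' E = 0},
        linSubst (Fin m × Fin m) ℂ (Matrix.diagonal t) D ∈
          Submodule.span ℂ {D' : MvPolynomial (Fin m × Fin m) ℂ |
            ∃ E ∈ annihilatorOfDegree
              (linSubst (Fin m × Fin m) ℂ (g : Matrix (Fin m × Fin m) (Fin m × Fin m) ℂ) (detPoly (Fin m) ℂ)) k,
            ∃ ν : ℤ, D' = weightedHomogeneousComponent (fun i => (w i : ℤ)) ν E ∧
              ∀ ν' : ℤ, ν' < ν → weightedHomogeneousComponent (fun i => (w i : ℤ)) ν' E = 0})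
    (hSH : ∀ C : Matrix (Fin m × Fin m) (Fin m × Fin m) ℂ,
      (∀ j i : Fin m × Fin m, C j i ≠ 0 →
        ¬ (((m - n ≤ (j.1 : ℕ) ∧ m - n ≤ (j.2 : ℕ)) ∨ j = (0, 0))) ∧
          (((m - n ≤ (i.1 : ℕ) ∧ m - n ≤ (i.2 : ℕ)) ∨ i = (0, 0)))) →
      ∀ k ≤ m, ∀ D ∈ Submodule.span ℂ {D' : MvPolynomial (Fin m × Fin m) ℂ |
          ∃ E ∈ annihilatorOfDegree
            (linSubst (Fin m × Fin m) ℂ (g : Matrix (Fin m × Fin m) (Fin m × Fin m) ℂ) (detPoly (Fin m) ℂ)) k,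
          ∃ ν : ℤ, D' = weightedHomogeneousComponent (fun i => (w i : ℤ)) ν E ∧
            ∀ ν' : ℤ, ν' < ν → weightedHomogeneousComponent (fun i => (w i : ℤ)) ν' E = 0},
        linSubst (Fin m × Fin m) ℂ (1 + C) D ∈
          Submodule.span ℂ {D' : MvPolynomial (Fin m × Fin m) ℂ |
            ∃ E ∈ annihilatorOfDegree
              (linSubst (Fin m × Fin m) ℂ (g : Matrix (Fin m × Fin m) (Fin m × Fin m) ℂ) (detPoly (Fin m) ℂ)) k,
            ∃ ν : ℤ, D' = weightedHomogeneousComponent (fun i => (w i : ℤ)) ν E ∧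
              ∀ ν' : ℤ, ν' < ν → weightedHomogeneousComponent (fun i => (w i : ℤ)) ν' E = 0})
    (hq1 : ∀ a : Fin m × Fin m, ((m - n ≤ (a.1 : ℕ) ∧ m - n ≤ (a.2 : ℕ)) ∨ a = (0, 0)) →
      ∀ b : Fin m × Fin m, (q : Matrix (Fin m × Fin m) (Fin m × Fin m) ℂ) b a = if b = a then 1 else 0)
    (hSB : ∀ L : Matrix.GeneralLinearGroup (Fin m × Fin m) ℂ,
      let M : Matrix (Fin m × Fin m) (Fin m × Fin m) ℂ := L
      let rk := fun (a : Fin m × Fin m) =>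
        (if (m - n ≤ (a.1 : ℕ) ∧ m - n ≤ (a.2 : ℕ)) ∨ a = (0, 0) then 0 else m * m) + ((a.1 : ℕ) * m + (a.2 : ℕ))
      (∀ a : Fin m × Fin m, ((m - n ≤ (a.1 : ℕ) ∧ m - n ≤ (a.2 : ℕ)) ∨ a = (0, 0)) →
        ∀ b : Fin m × Fin m, M b a = if b = a then 1 else 0) →
      (∀ i j : Fin m × Fin m, ¬ (((m - n ≤ (i.1 : ℕ) ∧ m - n ≤ (i.2 : ℕ)) ∨ i = (0, 0))) →
        ¬ (((m - n ≤ (j.1 : ℕ) ∧ m - n ≤ (j.2 : ℕ)) ∨ j = (0, 0))) → M j i ≠ 0 → rk j ≤ rk i) →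
      ∀ k ≤ m, ∀ D ∈ Submodule.span ℂ {D' : MvPolynomial (Fin m × Fin m) ℂ |
          ∃ E ∈ annihilatorOfDegree
            (linSubst (Fin m × Fin m) ℂ (g : Matrix (Fin m × Fin m) (Fin m × Fin m) ℂ) (detPoly (Fin m) ℂ)) k,
          ∃ ν : ℤ, D' = weightedHomogeneousComponent (fun i => (w i : ℤ)) ν E ∧
            ∀ ν' : ℤ, ν' < ν → weightedHomogeneousComponent (fun i => (w i : ℤ)) ν' E = 0},
        linSubst (Fin m × Fin m) ℂ (((q⁻¹ : GL (Fin m × Fin m) ℂ) : Matrix (Fin m × Fin m) (Fin m × Fin m) ℂ) *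
            (L : Matrix (Fin m × Fin m) (Fin m × Fin m) ℂ) * (q : Matrix (Fin m × Fin m) (Fin m × Fin m) ℂ))ᵀ D ∈
          Submodule.span ℂ {D' : MvPolynomial (Fin m × Fin m) ℂ |
            ∃ E ∈ annihilatorOfDegree
              (linSubst (Fin m × Fin m) ℂ (g : Matrix (Fin m × Fin m) (Fin m × Fin m) ℂ) (detPoly (Fin m) ℂ)) k,
            ∃ ν : ℤ, D' = weightedHomogeneousComponent (fun i => (w i : ℤ)) ν E ∧
              ∀ ν' : ℤ, ν' < ν → weightedHomogeneousComponent (fun i => (w i : ℤ)) ν' E = 0}) :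
    let F : MvPolynomial (Fin m × Fin m) ℂ :=
      linSubst (Fin m × Fin m) ℂ (g : Matrix (Fin m × Fin m) (Fin m × Fin m) ℂ) (detPoly (Fin m) ℂ)
    let wz : Fin m × Fin m → ℤ := fun i => (w i : ℤ)
    let J : ℕ → Set (MvPolynomial (Fin m × Fin m) ℂ) := fun k =>
      {D | linSubst (Fin m × Fin m) ℂ (q : Matrix (Fin m × Fin m) (Fin m × Fin m) ℂ)ᵀ D ∈
        Submodule.span ℂ {D' : MvPolynomial (Fin m × Fin m) ℂ |
          ∃ E ∈ annihilatorOfDegree F k, ∃ ν : ℤ, D' = weightedHomogeneousComponent wz ν E ∧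
            ∀ ν' : ℤ, ν' < ν → weightedHomogeneousComponent wz ν' E = 0}}
    IsBorderApolarLimit m (fun t : ℕ =>
        linSubst (Fin m × Fin m) ℂ (q : Matrix (Fin m × Fin m) (Fin m × Fin m) ℂ)
          (linSubst (Fin m × Fin m) ℂ (Matrix.diagonal fun i : Fin m × Fin m => ((t : ℂ) + 2) ^ (wz i)) F)) J ∧
    (∀ A : Matrix.GeneralLinearGroup (Fin m × Fin m) ℂ,
      let M : Matrix (Fin m × Fin m) (Fin m × Fin m) ℂ := A
      let rk := fun (a : Fin m × Fin m) =>
        (if (m - n ≤ (a.1 : ℕ) ∧ m - n ≤ (a.2 : ℕ)) ∨ a = (0, 0) then 0 else m * m) + ((a.1 : ℕ) * m + (a.2 : ℕ))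
      (∀ i j : Fin m × Fin m, M j i ≠ 0 → rk j ≤ rk i) →
      (∀ i j : Fin m × Fin m, ((m - n ≤ (i.1 : ℕ) ∧ m - n ≤ (i.2 : ℕ)) ∨ i = (0, 0)) → j ≠ i → M j i = 0) →
      (∀ i k j l : Fin m, m - n ≤ (i : ℕ) → m - n ≤ (k : ℕ) → m - n ≤ (j : ℕ) → m - n ≤ (l : ℕ) →
        M (i, j) (i, j) * M (k, l) (k, l) = M (i, l) (i, l) * M (k, j) (k, j)) →
      M (0, 0) (0, 0) ^ (m - n) * ∏ i ∈ Finset.univ.filter (fun i : Fin m => m - n ≤ (i : ℕ)), M (i, i) (i, i) = 1 →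
      ∀ k ≤ m, ∀ D ∈ J k, linSubst (Fin m × Fin m) ℂ Mᵀ D ∈ J k) ∧
    (∀ k ≤ m, ∀ D ∈ J k, apolarAction D (paddedPerPoly ℂ n m) = 0) := by
  intro F wz J
  have hlim := BorderApolarityToricFixedPoints.stub_toricLimitIsInitial m q wz F
  have hqunit : IsUnit (q : Matrix (Fin m × Fin m) (Fin m × Fin m) ℂ).det := Matrix.isUnits_det_units q
  -- `q` fixes the padded permanent
  have hqpp : linSubst (Fin m × Fin m) ℂ (q : Matrix (Fin m × Fin m) (Fin m × Fin m) ℂ)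
      (paddedPerPoly ℂ n m) = paddedPerPoly ℂ n m :=
    linSubst_paddedPerPoly_eq_self n m _ hq1
  -- every element of the initial span kills `pp`
  have hext' : ∀ d ∈ F.support, Finsupp.weight wz d ≤ (e : ℤ) := fun d hd => by
    show Finsupp.weight (fun i => (w i : ℤ)) d ≤ (e : ℤ)
    rw [BorderApolarityFixedWitnessObstructionQP.weight_natCast_eq]
    exact_mod_cast hext d hd
  have htop : weightedHomogeneousComponent wz (e : ℤ) F = paddedPerPoly ℂ n m := by
    show weightedHomogeneousComponent (fun i => (w i : ℤ)) (e : ℤ) F = _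
    rw [snf_weightedHomogeneousComponent_natCast, ← hrep]
  have hspan : ∀ k : ℕ, ∀ D' ∈ Submodule.span ℂ {D' : MvPolynomial (Fin m × Fin m) ℂ |
      ∃ E ∈ annihilatorOfDegree F k, ∃ ν : ℤ, D' = weightedHomogeneousComponent wz ν E ∧
        ∀ ν' : ℤ, ν' < ν → weightedHomogeneousComponent wz ν' E = 0},
      apolarAction D' (paddedPerPoly ℂ n m) = 0 := by
    intro k D' hD'
    induction hD' using Submodule.span_induction with
    | mem x hx =>
      obtain ⟨E, hE, ν, rfl, hmin⟩ := hx
      rw [← htop]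
      exact initialForm_apolar_topComponent wz F E (e : ℤ) ν hext' hE.2 hmin
    | zero => exact apolarAction_zero_left _
    | add x y _ _ hx hy => rw [apolarAction_add_left, hx, hy, add_zero]
    | smul a x _ hx => rw [apolarAction_smul_left, hx, smul_zero]
  refine ⟨hlim, ?_, ?_⟩
  · -- W4, reassembled from (ST), (SH), (SB)
    intro A M rk h1 h2 h3 h4 k hk D hD
    have hraw := rawW4_of_cleanStabilities n m q
      (fun k => {D : MvPolynomial (Fin m × Fin m) ℂ | D ∈ Submodule.span ℂ {D' : MvPolynomial (Fin m × Fin m) ℂ |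
        ∃ E ∈ annihilatorOfDegree F k, ∃ ν : ℤ, D' = weightedHomogeneousComponent wz ν E ∧
          ∀ ν' : ℤ, ν' < ν → weightedHomogeneousComponent wz ν' E = 0}})
      hq1 hST hSH hSB A h1 h2 h3 h4 k hk _ hD
    have hmat : (q : Matrix (Fin m × Fin m) (Fin m × Fin m) ℂ)ᵀ * Mᵀ =
        (((q⁻¹ : GL (Fin m × Fin m) ℂ) : Matrix (Fin m × Fin m) (Fin m × Fin m) ℂ) *
          M * (q : Matrix (Fin m × Fin m) (Fin m × Fin m) ℂ))ᵀ *
          (q : Matrix (Fin m × Fin m) (Fin m × Fin m) ℂ)ᵀ := by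
      rw [← Matrix.transpose_mul, ← Matrix.transpose_mul, ← Matrix.mul_assoc, ← Matrix.mul_assoc,
        Units.mul_inv, Matrix.one_mul]
    have key : linSubst (Fin m × Fin m) ℂ (q : Matrix (Fin m × Fin m) (Fin m × Fin m) ℂ)ᵀ
        (linSubst (Fin m × Fin m) ℂ Mᵀ D) =
        linSubst (Fin m × Fin m) ℂ (((q⁻¹ : GL (Fin m × Fin m) ℂ) : Matrix (Fin m × Fin m) (Fin m × Fin m) ℂ) *
          M * (q : Matrix (Fin m × Fin m) (Fin m × Fin m) ℂ))ᵀ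
          (linSubst (Fin m × Fin m) ℂ (q : Matrix (Fin m × Fin m) (Fin m × Fin m) ℂ)ᵀ D) := by
      rw [← AlgHom.comp_apply, ← linSubst_mul, ← AlgHom.comp_apply, ← linSubst_mul, hmat]
    have h2 : linSubst (Fin m × Fin m) ℂ (q : Matrix (Fin m × Fin m) (Fin m × Fin m) ℂ)ᵀ
        (linSubst (Fin m × Fin m) ℂ Mᵀ D) ∈
        Submodule.span ℂ {D' : MvPolynomial (Fin m × Fin m) ℂ |
          ∃ E ∈ annihilatorOfDegree F k, ∃ ν : ℤ, D' = weightedHomogeneousComponent wz ν E ∧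
            ∀ ν' : ℤ, ν' < ν → weightedHomogeneousComponent wz ν' E = 0} := by
      rw [key]
      exact hraw
    exact Eq.mpr (Set.mem_setOf_eq (x := linSubst (Fin m × Fin m) ℂ Mᵀ D)
      (p := fun D' : MvPolynomial (Fin m × Fin m) ℂ =>
        linSubst (Fin m × Fin m) ℂ (q : Matrix (Fin m × Fin m) (Fin m × Fin m) ℂ)ᵀ D' ∈
          Submodule.span ℂ {D' : MvPolynomial (Fin m × Fin m) ℂ |
            ∃ E ∈ annihilatorOfDegree F k, ∃ ν : ℤ, D' = weightedHomogeneousComponent wz ν E ∧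
              ∀ ν' : ℤ, ν' < ν → weightedHomogeneousComponent wz ν' E = 0})) h2
  · -- W5: `qᵀ D` lies in the initial span, which kills `pp`, and `q` fixes `pp`
    intro k _ D hD
    have h0 : apolarAction (linSubst (Fin m × Fin m) ℂ (q : Matrix (Fin m × Fin m) (Fin m × Fin m) ℂ)ᵀ D)
        (paddedPerPoly ℂ n m) = 0 := hspan k _ hD
    have h1 := (apolarAction_linSubst_eq_zero_iff _ hqunit D (paddedPerPoly ℂ n m)).2 h0
    rw [hqpp] at h1
    exact h1

/-! ## The equivalence -/

/-- **The crux is equivalent to its stable algebraic normal form.**  See the module docstring for the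
shape of the right-hand side ((EXT) ∧ (REP) ∧ (ADD) ∧ (ST) ∧ (SH) ∧ (SZ) ∧ (P1) ∧ (SB)) and for the two
directions. [folklore] -/
theorem toricWitnessObstructionQP_iff_noStableNormalForm :
    Summit.ValiantsHypothesis.ValiantsHypothesis.Theses.BorderApolarity.ToricWitnessObstructionQP ↔
    ( ∀ c : ℕ, ∃ n₀ : ℕ, ∀ n ≥ n₀, ∀ (m : ℕ) [NeZero m], n ≤ m →
    m ≤ 2 ^ ((Nat.log 2 n + c) ^ c) →
    ¬ ∃ (g : GL (Fin m × Fin m) ℂ) (w : Fin m × Fin m → ℕ) (e : ℕ) (q : GL (Fin m × Fin m) ℂ),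
      let ess := fun a : Fin m × Fin m => (m - n ≤ (a.1 : ℕ) ∧ m - n ≤ (a.2 : ℕ)) ∨ a = (0, 0)
      let rk := fun (a : Fin m × Fin m) => (if ess a then 0 else m * m) + ((a.1 : ℕ) * m + (a.2 : ℕ))
      let F : MvPolynomial (Fin m × Fin m) ℂ :=
        linSubst (Fin m × Fin m) ℂ (g : Matrix (Fin m × Fin m) (Fin m × Fin m) ℂ) (detPoly (Fin m) ℂ)
      let J' : ℕ → Set (MvPolynomial (Fin m × Fin m) ℂ) := fun k =>
        {D | D ∈ Submodule.span ℂ {D' : MvPolynomial (Fin m × Fin m) ℂ |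
          ∃ E ∈ annihilatorOfDegree F k, ∃ ν : ℤ,
            D' = weightedHomogeneousComponent (fun i => (w i : ℤ)) ν E ∧
            ∀ ν' : ℤ, ν' < ν → weightedHomogeneousComponent (fun i => (w i : ℤ)) ν' E = 0}}
      (∀ d ∈ F.support, Finsupp.weight w d ≤ e) ∧
      paddedPerPoly ℂ n m = weightedHomogeneousComponent w e F ∧
      (∀ i j k l : Fin m, m - n ≤ (i : ℕ) → m - n ≤ (k : ℕ) → m - n ≤ (j : ℕ) → m - n ≤ (l : ℕ) →
        w (i, j) + w (k, l) = w (i, l) + w (k, j)) ∧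
      (∀ t : Fin m × Fin m → ℂ, (∀ i, t i ≠ 0) → (∀ z, ¬ ess z → t z = 1) →
        (∀ i k j l : Fin m, m - n ≤ (i : ℕ) → m - n ≤ (k : ℕ) → m - n ≤ (j : ℕ) → m - n ≤ (l : ℕ) →
          t (i, j) * t (k, l) = t (i, l) * t (k, j)) →
        t (0, 0) ^ (m - n) * ∏ i ∈ Finset.univ.filter (fun i : Fin m => m - n ≤ (i : ℕ)), t (i, i) = 1 →
        ∀ k ≤ m, ∀ D ∈ J' k, linSubst (Fin m × Fin m) ℂ (Matrix.diagonal t) D ∈ J' k) ∧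
      (∀ C : Matrix (Fin m × Fin m) (Fin m × Fin m) ℂ, (∀ j i, C j i ≠ 0 → ¬ ess j ∧ ess i) →
        ∀ k ≤ m, ∀ D ∈ J' k, linSubst (Fin m × Fin m) ℂ (1 + C) D ∈ J' k) ∧
      (∀ c : ℂ, c ≠ 0 → ∀ k ≤ m, ∀ D ∈ J' k,
        linSubst (Fin m × Fin m) ℂ (Matrix.diagonal fun i => if ess i then 1 else c) D ∈ J' k) ∧
      (∀ a, ess a → ∀ b, (q : Matrix (Fin m × Fin m) (Fin m × Fin m) ℂ) b a = if b = a then 1 else 0) ∧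
      (∀ L : Matrix.GeneralLinearGroup (Fin m × Fin m) ℂ,
        let M : Matrix (Fin m × Fin m) (Fin m × Fin m) ℂ := L
        (∀ a, ess a → ∀ b, M b a = if b = a then 1 else 0) →
        (∀ i j, ¬ ess i → ¬ ess j → M j i ≠ 0 → rk j ≤ rk i) →
        ∀ k ≤ m, ∀ D ∈ J' k,
          linSubst (Fin m × Fin m) ℂ (((q⁻¹ : GL (Fin m × Fin m) ℂ) : Matrix (Fin m × Fin m) (Fin m × Fin m) ℂ) *
            M * (q : Matrix (Fin m × Fin m) (Fin m × Fin m) ℂ))ᵀ D ∈ J' k)) := by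
  constructor
  · -- (⇒) crux ⟹ normal form: normal-form data assemble a toric witness
    intro hT c
    obtain ⟨n₀, hn₀⟩ := hT c
    refine ⟨n₀, ?_⟩
    intro n hn m inst hnm hm
    have hW := @hn₀ n hn m inst hnm hm
    dsimp only at hW ⊢
    rintro ⟨g, w, e, q, hext, hrep, -, hST, hSH, -, hq1, hSB⟩
    obtain ⟨hlim, hW4, hW5⟩ := snf_witness_of_stableData n m g w e q hext hrep hST hSH hq1 hSB
    exact hW ⟨q, g, _, _, hlim.1, hlim.2, hW4, hW5⟩
  · -- (⇐) normal form ⟹ crux: the composition of line `Sketch`, reshape 4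
    intro hR c
    obtain ⟨n₁, hn₁⟩ := hR c
    refine ⟨max n₁ 3, ?_⟩
    intro n hn m inst hnm hm
    have h3 : 3 ≤ n := le_trans (le_max_right _ _) hn
    have hn₁' : n₁ ≤ n := le_trans (le_max_left _ _) hn
    have hres := @hn₁ n hn₁' m inst hnm hm
    dsimp only at hres ⊢
    rintro ⟨u, g, w, J, hW2, hW3, hW4, hW5⟩
    -- stub 1: socle with relations
    obtain ⟨μ, c₀, e, hμ, hc₀, hext, hpp⟩ :=
      stub_socleMaxRel n m hnm J u g w (hW3 m le_rfl) (hW5 m le_rfl)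
    set w₁ : Fin m × Fin m → ℕ := fun i => (w i - c₀).toNat with hw₁
    have hw : ∀ i, w i = (w₁ i : ℤ) + c₀ := fun i => by
      rw [hw₁]
      dsimp only
      rw [Int.toNat_of_nonneg (sub_nonneg.2 (hc₀ i))]
      ring
    -- stub 3: normal form with relations
    obtain ⟨p, g', w', hP1, hconj, hFg', hext', hpp', hadd'⟩ :=
      stub_normalFormRel n m h3 hnm u g w₁ e μ hμ hext hpp
    -- stub 2: the limit `J` is the `pᵀ`-translate of `J' := in_{w'}(Ann(g'·det))`
    have hJ := stub_limitTransfer m J u g p g' w c₀ w₁ w' μ hμ hw hconj hFg' ⟨hW2, hW3⟩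
    set J' : ℕ → Set (MvPolynomial (Fin m × Fin m) ℂ) := fun k =>
      {D | D ∈ Submodule.span ℂ {D' : MvPolynomial (Fin m × Fin m) ℂ |
        ∃ E ∈ annihilatorOfDegree
          (linSubst (Fin m × Fin m) ℂ (g' : Matrix (Fin m × Fin m) (Fin m × Fin m) ℂ) (detPoly (Fin m) ℂ)) k,
        ∃ ν : ℤ, D' = weightedHomogeneousComponent (fun i => (w' i : ℤ)) ν E ∧
          ∀ ν' : ℤ, ν' < ν → weightedHomogeneousComponent (fun i => (w' i : ℤ)) ν' E = 0}} with hJ'def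
    have hJ'' : ∀ k ≤ m, J k =
        {D | linSubst (Fin m × Fin m) ℂ (p : Matrix (Fin m × Fin m) (Fin m × Fin m) ℂ)ᵀ D ∈ J' k} := by
      intro k hk
      rw [hJ k hk]
      exact Set.ext fun D => Iff.rfl
    -- W4 transported
    have hraw : ∀ A : Matrix.GeneralLinearGroup (Fin m × Fin m) ℂ,
        let M : Matrix (Fin m × Fin m) (Fin m × Fin m) ℂ := A
        let rk := fun (q : Fin m × Fin m) =>
          (if (m - n ≤ (q.1 : ℕ) ∧ m - n ≤ (q.2 : ℕ)) ∨ q = (0, 0) then 0 else m * m) + ((q.1 : ℕ) * m + (q.2 : ℕ))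
        (∀ i j : Fin m × Fin m, M j i ≠ 0 → rk j ≤ rk i) →
        (∀ i j : Fin m × Fin m, ((m - n ≤ (i.1 : ℕ) ∧ m - n ≤ (i.2 : ℕ)) ∨ i = (0, 0)) → j ≠ i → M j i = 0) →
        (∀ i k j l : Fin m, m - n ≤ (i : ℕ) → m - n ≤ (k : ℕ) → m - n ≤ (j : ℕ) → m - n ≤ (l : ℕ) →
          M (i, j) (i, j) * M (k, l) (k, l) = M (i, l) (i, l) * M (k, j) (k, j)) →
        M (0, 0) (0, 0) ^ (m - n) * ∏ i ∈ Finset.univ.filter (fun i : Fin m => m - n ≤ (i : ℕ)), M (i, i) (i, i) = 1 →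
        ∀ k ≤ m, ∀ D ∈ J' k,
          linSubst (Fin m × Fin m) ℂ (((p⁻¹ : GL (Fin m × Fin m) ℂ) : Matrix (Fin m × Fin m) (Fin m × Fin m) ℂ) *
            M * (p : Matrix (Fin m × Fin m) (Fin m × Fin m) ℂ))ᵀ D ∈ J' k := by
      intro A M rk h1 h2 h3' h4
      exact snf_rawW4_transfer p J J' hJ'' M (hW4 A h1 h2 h3' h4)
    -- stubs 4–6: the unpacked stabilities of `J'`
    have hSH := stub_stabHom n m p J' hP1 hraw
    have hST := stub_stabTorus n m p J' hP1 hraw hSH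
    obtain ⟨hSZ, hSB⟩ := stub_stabScalarBorel n m p J' hP1 hraw hSH
    -- the residual
    exact hres ⟨g', w', e, p, hext', hpp', hadd', hST, hSH, hSZ, hP1, hSB⟩


end

end Summit.ValiantsHypothesis.ValiantsHypothesis.Theorems.BorderApolarityToricWitnessObstructionQP
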